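import Mathlib.Data.Nat.Choose.Sum
import Mathlib.Algebra.BigOperators.Intervals
import Mathlib.Algebra.BigOperators.Ring.Finset
import Mathlib.Data.Real.Basic
import Mathlib.Tactic
import HarnessLib

/-!
# Composition sums: the coefficients of `exp(m log(1 − t))` and of `log(exp t)`

Elementary identities on the numbers

  `E_r(n) = ∑_{j₁ + ⋯ + j_r = n, j_i ≥ 1} w(j₁) ⋯ w(j_r)`     (`compSum w r n`),

the coefficient of `t^n` in `(∑_{j ≥ 1} w(j) t^j)^r`, for a weight sequence `w : ℕ → ℝ`. Everything
here is PROVED; these are the scalar identities behind `exp ∘ log = id` and `log ∘ exp = id`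
for (pro-)nilpotent elements of a commutative `ℚ`-algebra, in the form used to expand powers of
a sum of convolution powers (`Literature/Analysis/Convolution/OneSided*.lean`, Ford–Maynard's
modified Liouville functions).

* `compSum`, `compSum_succ`, `compSum_eq_zero_of_lt`, `compSum_one`;
* `cast_mul_compSum_succ` — the weighted identity `n E_{r+1}(n) = (r+1) ∑_j j w(j) E_r(n − j)`
  ("`t d/dt`" applied to `(∑ w_j t^j)^{r+1}`), by induction on `r`;
* weights `wLog j = −1/j` (`log(1 − t)`): `aCoeff m n = ∑_r (m^r/r!) E_r(n)` satisfies
  `(n+1) a_{n+1} = −m (a_0 + ⋯ + a_n)` (`succ_mul_aCoeff_succ`) and hence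
  **`aCoeff_eq`: `∑_r (m^r/r!) E_r(n) = (−1)^n (m choose n)`** — `exp(m log(1−t)) = (1−t)^m`;
* weights `wExp i = 1/i!` (`e^t − 1`): the Stirling-type recursion `succ_mul_compSum_wExp` and
  **`bCoeff_eq`: `∑_{j=1}^{n} ((−1)^{j+1}/j) E_j(n) = [n = 1]`** (`n ≥ 1`) — `log(exp t) = t`.

## References

Standard generating-function identities (e.g. L. Comtet, *Advanced Combinatorics*, Ch. III, or
R. Stanley, *Enumerative Combinatorics* 2, §5.1); no single source is followed. Mathlib (pinned)
has `Nat.stirlingFirst/stirlingSecond` with their recursions, `PowerSeries.exp` and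
`PowerSeries.log` (`log(1+X)`, its derivative) but not `exp ∘ log = id`; the partial alternating
binomial sum `Int.alternating_sum_range_choose_eq_choose` and `Nat.add_one_mul_choose_eq` are
used.
-/

noncomputable section

open Finset

namespace Literature.Combinatorics.Enumerative

/-- `compSum w r n = ∑ w(j₁) ⋯ w(j_r)` over the compositions `j₁ + ⋯ + j_r = n` of `n` into `r`
parts `j_i ≥ 1`, defined recursively on `r`. [folklore] -/
def compSum (w : ℕ → ℝ) : ℕ → ℕ → ℝ
  | 0, n => if n = 0 then 1 else 0
  | r + 1, n => ∑ j ∈ Icc 1 n, w j * compSum w r (n - j)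

variable (w : ℕ → ℝ)

/-- The empty composition: `E_0(0) = 1`. [folklore] -/
@[simp] theorem compSum_zero_zero : compSum w 0 0 = 1 := by simp [compSum]

/-- `E_0(n) = 0` for `n ≠ 0`. [folklore] -/
theorem compSum_zero_of_ne_zero {n : ℕ} (hn : n ≠ 0) : compSum w 0 n = 0 := by simp [compSum, hn]

/-- The defining recursion on the first part: `E_{r+1}(n) = ∑_{j=1}^{n} w(j) E_r(n − j)`. [folklore] -/
theorem compSum_succ (r n : ℕ) :
    compSum w (r + 1) n = ∑ j ∈ Icc 1 n, w j * compSum w r (n - j) := by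
  simp [compSum]

/-- Compositions of `n` into `r` positive parts exist only for `r ≤ n`. [folklore] -/
theorem compSum_eq_zero_of_lt : ∀ {r n : ℕ}, n < r → compSum w r n = 0
  | 0, _, h => (Nat.not_lt_zero _ h).elim
  | r + 1, n, h => by
    rw [compSum_succ]
    refine sum_eq_zero fun j hj => ?_
    rw [mem_Icc] at hj
    rw [compSum_eq_zero_of_lt (by omega), mul_zero]

/-- `compSum w 1 n = w n` for `n ≥ 1`. [folklore] -/
theorem compSum_one {n : ℕ} (hn : 1 ≤ n) : compSum w 1 n = w n := by
  rw [compSum_succ, sum_eq_single_of_mem n (by simp; omega)]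
  · simp
  · intro j hj hjn
    rw [mem_Icc] at hj
    rw [compSum_zero_of_ne_zero w (by omega), mul_zero]

/-- **The weighted composition identity** `n E_{r+1}(n) = (r+1) ∑_j j w(j) E_r(n − j)`:
differentiating `(∑ w_j t^j)^{r+1}` gives `(r+1) (∑ w_j t^j)^r · ∑ j w_j t^j`. [folklore] -/
theorem cast_mul_compSum_succ (r n : ℕ) :
    (n : ℝ) * compSum w (r + 1) n =
      (r + 1 : ℝ) * ∑ j ∈ Icc 1 n, (j : ℝ) * w j * compSum w r (n - j) := by
  induction r generalizing n with
  | zero =>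
    rcases Nat.eq_zero_or_pos n with rfl | hn
    · simp [compSum_succ]
    · rw [compSum_one w hn, Nat.cast_zero, zero_add, one_mul, sum_eq_single_of_mem n (by simp; omega)]
      · simp
      · intro j hj hjn
        rw [mem_Icc] at hj
        rw [compSum_zero_of_ne_zero w (by omega), mul_zero]
  | succ r ih =>
    -- n E_{r+2}(n) = ∑_j w j (j + (n-j)) E_{r+1}(n-j)
    have step1 : (n : ℝ) * compSum w (r + 2) n =
        ∑ j ∈ Icc 1 n, (j : ℝ) * w j * compSum w (r + 1) (n - j) +
          ∑ j ∈ Icc 1 n, w j * (((n - j : ℕ) : ℝ) * compSum w (r + 1) (n - j)) := by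
      rw [compSum_succ, mul_sum, ← sum_add_distrib]
      refine sum_congr rfl fun j hj => ?_
      rw [mem_Icc] at hj
      have : (n : ℝ) = (j : ℝ) + ((n - j : ℕ) : ℝ) := by
        rw [Nat.cast_sub hj.2]; ring
      rw [this]; ring
    rw [step1]
    -- apply ih inside the second sum
    have step2 : ∑ j ∈ Icc 1 n, w j * (((n - j : ℕ) : ℝ) * compSum w (r + 1) (n - j)) =
        (r + 1 : ℝ) * ∑ i ∈ Icc 1 n, (i : ℝ) * w i * compSum w (r + 1) (n - i) := by
      simp_rw [ih]
      -- ∑_j w j * ((r+1) ∑_{i ≤ n-j} i w i E_r(n-j-i)) = (r+1) ∑_i i w i ∑_{j ≤ n - i} w j E_r (n-i-j)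
      simp_rw [mul_sum, compSum_succ, mul_sum]
      rw [sum_sigma', sum_sigma']
      refine sum_nbij' (fun p => ⟨p.2, p.1⟩) (fun p => ⟨p.2, p.1⟩) ?_ ?_ ?_ ?_ ?_
      · rintro ⟨j, i⟩ hp
        simp only [mem_sigma, mem_Icc] at hp ⊢
        omega
      · rintro ⟨i, j⟩ hp
        simp only [mem_sigma, mem_Icc] at hp ⊢
        omega
      · rintro ⟨j, i⟩ _; rfl
      · rintro ⟨i, j⟩ _; rfl
      · rintro ⟨j, i⟩ hp
        simp only [mem_sigma, mem_Icc] at hp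
        have h1 : n - j - i = n - i - j := by omega
        simp only [h1]
        ring
    rw [step2]
    push_cast
    ring

/-! ### `exp(m log(1 − t)) = (1 − t)^m`: the coefficients -/

/-- The weights `−1/j` of `log(1 − t) = −∑_{j ≥ 1} t^j/j`. [folklore] -/
def wLog (j : ℕ) : ℝ := -1 / j

/-- `aCoeff m n = ∑_{r} (m^r/r!) E_r(n)` with the weights `−1/j`: the coefficient of `t^n` in
`∑_r (m log(1 − t))^r / r! = exp(m log(1 − t))`. [folklore] -/
def aCoeff (m n : ℕ) : ℝ :=
  ∑ r ∈ range (n + 1), (m : ℝ) ^ r / r.factorial * compSum wLog r n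

/-- `a_0 = 1`. [folklore] -/
theorem aCoeff_zero (m : ℕ) : aCoeff m 0 = 1 := by
  simp [aCoeff]

/-- The range of `r` in `aCoeff` may be enlarged (the extra terms vanish). [folklore] -/
theorem aCoeff_eq_sum_range {m n N : ℕ} (hN : n + 1 ≤ N) :
    aCoeff m n = ∑ r ∈ range N, (m : ℝ) ^ r / r.factorial * compSum wLog r n := by
  rw [aCoeff, ← sum_range_add_sum_Ico _ hN, left_eq_add]
  refine sum_eq_zero fun r hr => ?_
  rw [mem_Ico] at hr
  rw [compSum_eq_zero_of_lt wLog (by omega), mul_zero]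

/-- The recursion `(n+1) a_{n+1} = −m (a_0 + ⋯ + a_n)`, i.e. `(1 − t) F' = −m F` for
`F = exp(m log(1 − t))`. [folklore] -/
theorem succ_mul_aCoeff_succ (m n : ℕ) :
    (n + 1 : ℝ) * aCoeff m (n + 1) = -(m : ℝ) * ∑ l ∈ range (n + 1), aCoeff m l := by
  -- expand the left side, dropping the `r = 0` term
  have hL : (n + 1 : ℝ) * aCoeff m (n + 1) =
      ∑ r ∈ range (n + 1), (m : ℝ) ^ (r + 1) / (r + 1).factorial *
        ((r + 1 : ℝ) * ∑ j ∈ Icc 1 (n + 1), (j : ℝ) * wLog j * compSum wLog r (n + 1 - j)) := by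
    rw [aCoeff, sum_range_succ', mul_add]
    have h0 : (m : ℝ) ^ 0 / (Nat.factorial 0) * compSum wLog 0 (n + 1) = 0 := by
      rw [compSum_zero_of_ne_zero wLog (by omega), mul_zero]
    rw [h0, mul_zero, add_zero, mul_sum]
    refine sum_congr rfl fun r _ => ?_
    rw [← cast_mul_compSum_succ]; push_cast; ring
  -- `j * wLog j = -1`
  have hjw : ∀ r, ∑ j ∈ Icc 1 (n + 1), (j : ℝ) * wLog j * compSum wLog r (n + 1 - j) =
      -∑ l ∈ range (n + 1), compSum wLog r l := by
    intro r
    rw [← sum_neg_distrib]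
    refine sum_nbij' (fun j => n + 1 - j) (fun l => n + 1 - l) ?_ ?_ ?_ ?_ ?_
    · intro j hj; simp only [mem_Icc] at hj; simp only [mem_range]; omega
    · intro l hl; simp only [mem_range] at hl; simp only [mem_Icc]; omega
    · intro j hj; simp only [mem_Icc] at hj; omega
    · intro l hl; simp only [mem_range] at hl; omega
    · intro j hj
      simp only [mem_Icc] at hj
      have hj0 : (j : ℝ) ≠ 0 := by exact_mod_cast (show j ≠ 0 by omega)
      rw [wLog]; field_simp
  simp_rw [hjw] at hL
  rw [hL]
  -- rewrite `a m l` with the enlarged range `r < n + 1`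
  have hR : ∑ l ∈ range (n + 1), aCoeff m l =
      ∑ l ∈ range (n + 1), ∑ r ∈ range (n + 1), (m : ℝ) ^ r / r.factorial * compSum wLog r l := by
    refine sum_congr rfl fun l hl => ?_
    rw [mem_range] at hl
    exact aCoeff_eq_sum_range (by omega)
  rw [hR, sum_comm, mul_sum]
  refine sum_congr rfl fun r _ => ?_
  have hre : -(m : ℝ) * ∑ i ∈ range (n + 1), (m : ℝ) ^ r / r.factorial * compSum wLog r i =
      -(m : ℝ) * ((m : ℝ) ^ r / r.factorial) * ∑ i ∈ range (n + 1), compSum wLog r i := by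
    rw [mul_sum, mul_sum]
    exact sum_congr rfl fun i _ => by ring
  rw [hre, pow_succ, Nat.factorial_succ]
  push_cast
  have hr : ((r.factorial : ℕ) : ℝ) ≠ 0 := by exact_mod_cast r.factorial_ne_zero
  have hr1 : (r + 1 : ℝ) ≠ 0 := by positivity
  field_simp

/-- **`exp(m log(1 − t)) = (1 − t)^m`, coefficientwise**: `∑_r (m^r/r!) E_r(n) = (−1)^n (m choose n)`
for the composition sums `E_r` with weights `−1/j`. [folklore] -/
theorem aCoeff_eq (m : ℕ) : ∀ n : ℕ, aCoeff m n = (-1) ^ n * (m.choose n : ℝ) := by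
  intro n
  induction n using Nat.strong_induction_on with
  | _ n ih =>
    cases n with
    | zero => simp [aCoeff_zero]
    | succ n =>
      have hrec := succ_mul_aCoeff_succ m n
      have hsum : ∑ l ∈ range (n + 1), aCoeff m l =
          ∑ l ∈ range (n + 1), (-1 : ℝ) ^ l * (m.choose l : ℝ) :=
        sum_congr rfl fun l hl => ih l (mem_range.mp hl)
      rw [hsum] at hrec
      have hn1 : (n + 1 : ℝ) ≠ 0 := by positivity
      cases m with
      | zero =>
        simp only [Nat.cast_zero, neg_zero, zero_mul, mul_eq_zero, hn1, false_or] at hrec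
        rw [hrec, Nat.choose_eq_zero_of_lt (by omega)]
        simp
      | succ m =>
        have halt : ∑ l ∈ range (n + 1), (-1 : ℝ) ^ l * ((m + 1).choose l : ℝ) =
            (-1) ^ n * (m.choose n : ℝ) := by
          have := Int.alternating_sum_range_choose_eq_choose (n := m) (m := n)
          exact_mod_cast this
        rw [halt] at hrec
        have hkey : ((m + 1 : ℕ) : ℝ) * (m.choose n : ℝ) = ((m + 1).choose (n + 1) : ℝ) * (n + 1 : ℝ) := by
          exact_mod_cast Nat.add_one_mul_choose_eq m n
        apply mul_left_cancel₀ hn1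
        rw [hrec]
        calc -((m + 1 : ℕ) : ℝ) * ((-1) ^ n * (m.choose n : ℝ))
            = -((-1) ^ n * (((m + 1 : ℕ) : ℝ) * (m.choose n : ℝ))) := by ring
          _ = -((-1) ^ n * (((m + 1).choose (n + 1) : ℝ) * (n + 1 : ℝ))) := by rw [hkey]
          _ = (n + 1 : ℝ) * ((-1) ^ (n + 1) * ((m + 1).choose (n + 1) : ℝ)) := by ring

/-! ### `log(exp t) = t`: the coefficients -/

/-- The weights `1/i!` of `exp(t) − 1 = ∑_{i ≥ 1} t^i/i!`. [folklore] -/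
def wExp (i : ℕ) : ℝ := 1 / i.factorial

/-- The Stirling-type recursion `(n+1) G_{j+1}(n+1) = (j+1) (G_j(n) + G_{j+1}(n))` for the
coefficients `G_j(n) = E_j(n)` of `(e^t − 1)^j` (weights `1/i!`). [folklore] -/
theorem succ_mul_compSum_wExp (j n : ℕ) :
    (n + 1 : ℝ) * compSum wExp (j + 1) (n + 1) =
      (j + 1 : ℝ) * (compSum wExp j n + compSum wExp (j + 1) n) := by
  have h := cast_mul_compSum_succ wExp j (n + 1)
  push_cast at h
  rw [h]
  congr 1
  -- `∑_{i=1}^{n+1} i wExp i G_j(n+1-i) = ∑_{k=0}^{n} wExp k G_j(n-k) = G_j n + G_{j+1} n`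
  have hw : ∀ k : ℕ, ((k + 1 : ℕ) : ℝ) * wExp (k + 1) = wExp k := by
    intro k
    rw [wExp, wExp, Nat.factorial_succ]
    push_cast
    have hk : ((k.factorial : ℕ) : ℝ) ≠ 0 := by exact_mod_cast k.factorial_ne_zero
    have hk1 : (k + 1 : ℝ) ≠ 0 := by positivity
    field_simp
  have h1 : ∑ i ∈ Icc 1 (n + 1), (i : ℝ) * wExp i * compSum wExp j (n + 1 - i) =
      ∑ k ∈ range (n + 1), wExp k * compSum wExp j (n - k) := by
    rw [show Icc 1 (n + 1) = Ico 1 (n + 1 + 1) by rfl, sum_Ico_eq_sum_range]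
    refine sum_congr (by rfl) fun k _ => ?_
    rw [show 1 + k = k + 1 by omega, hw k]
    congr 2
    omega
  rw [h1, sum_range_succ', compSum_succ]
  have h2 : ∑ i ∈ Icc 1 n, wExp i * compSum wExp j (n - i) =
      ∑ k ∈ range n, wExp (k + 1) * compSum wExp j (n - (k + 1)) := by
    rw [show Icc 1 n = Ico 1 (n + 1) by rfl, sum_Ico_eq_sum_range]
    refine sum_congr (by simp) fun k _ => ?_
    rw [show 1 + k = k + 1 by omega]
  rw [h2, wExp]
  simp only [Nat.factorial_zero, Nat.cast_one, div_one, one_mul, Nat.sub_zero]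
  ring

/-- `bCoeff n = ∑_{j=1}^{n} ((−1)^{j+1}/j) G_j(n)`: the coefficient of `t^n` in
`∑_j ((−1)^{j+1}/j) (e^t − 1)^j = log(exp t)`. [folklore] -/
def bCoeff (n : ℕ) : ℝ :=
  ∑ j ∈ Icc 1 n, (-1 : ℝ) ^ (j + 1) / j * compSum wExp j n

/-- Alternating telescoping: `∑_{j < N} (−1)^j (x_j + x_{j+1}) = x_0 − (−1)^N x_N`. [folklore] -/
theorem sum_range_neg_one_pow_mul_add (x : ℕ → ℝ) (N : ℕ) :
    ∑ j ∈ range N, (-1 : ℝ) ^ j * (x j + x (j + 1)) = x 0 - (-1) ^ N * x N := by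
  induction N with
  | zero => simp
  | succ N ih => rw [sum_range_succ, ih, pow_succ]; ring

/-- **`log(exp t) = t`, coefficientwise**: `∑_{j=1}^{n} ((−1)^{j+1}/j) G_j(n) = [n = 1]` for
`n ≥ 1`, where `G_j(n)` (`compSum wExp j n`) is the coefficient of `t^n` in `(e^t − 1)^j`.
[folklore] -/
theorem bCoeff_eq {n : ℕ} (hn : 1 ≤ n) : bCoeff n = if n = 1 then 1 else 0 := by
  obtain ⟨n, rfl⟩ : ∃ n', n = n' + 1 := ⟨n - 1, by omega⟩
  -- `(n+1) b(n+1) = ∑_{j'=0}^{n} (−1)^{j'} (G_{j'}(n) + G_{j'+1}(n)) = G_0(n)`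
  have hmul : (n + 1 : ℝ) * bCoeff (n + 1) =
      ∑ j ∈ range (n + 1), (-1 : ℝ) ^ j * (compSum wExp j n + compSum wExp (j + 1) n) := by
    rw [bCoeff, mul_sum, show Icc 1 (n + 1) = Ico 1 (n + 1 + 1) by rfl, sum_Ico_eq_sum_range]
    refine sum_congr (by rfl) fun j _ => ?_
    rw [show 1 + j = j + 1 by omega]
    have hj : (j + 1 : ℝ) ≠ 0 := by positivity
    have key := succ_mul_compSum_wExp j n
    calc (n + 1 : ℝ) * ((-1) ^ (j + 1 + 1) / ((j + 1 : ℕ) : ℝ) * compSum wExp (j + 1) (n + 1))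
        = (-1) ^ (j + 1 + 1) / ((j + 1 : ℕ) : ℝ) * ((n + 1 : ℝ) * compSum wExp (j + 1) (n + 1)) := by
          ring
      _ = (-1) ^ (j + 1 + 1) / ((j + 1 : ℕ) : ℝ) *
            ((j + 1 : ℝ) * (compSum wExp j n + compSum wExp (j + 1) n)) := by rw [key]
      _ = (-1 : ℝ) ^ j * (compSum wExp j n + compSum wExp (j + 1) n) := by
          push_cast
          field_simp
          ring
  rw [sum_range_neg_one_pow_mul_add (fun j => compSum wExp j n) (n + 1)] at hmul
  simp only [compSum_eq_zero_of_lt wExp (Nat.lt_succ_self n), mul_zero, sub_zero] at hmul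
  have hn1 : (n + 1 : ℝ) ≠ 0 := by positivity
  rcases Nat.eq_zero_or_pos n with rfl | hpos
  · simp only [zero_add, compSum_zero_zero, Nat.cast_zero, one_mul] at hmul ⊢
    simpa using hmul
  · rw [compSum_zero_of_ne_zero wExp hpos.ne', mul_eq_zero] at hmul
    rcases hmul with h | h
    · exact (hn1 h).elim
    · rw [h, if_neg (by omega)]

end Literature.Combinatorics.Enumerative
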